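import Summits.BirchSwinnertonDyer.Rank1Residual.AdditivePotMult.NonPrimitiveMuTransferOdd
import Summits.BirchSwinnertonDyer.Rank1Residual.Additive.CongruentPartnerBudgetSchemaHolds
import HarnessLib

/-!
# GV p. 27 "`λ_{E₂,Σ₀} = λ_{E₁,Σ₀}`" for the NON-PRIMITIVE Selmer duals at every odd additive prime of
# the four loci, modulo the Prop.-(2.5)-shaped input "no non-zero finite `Λ`-submodule" taken as an
# explicit per-datum binder (and `hGrK` / A40–A41): `λ(X^{Σ₀}_1) = λ(X^{Σ₀}_2)`
# (cell `b2b-bsdres`, team n1011, seat p12 (gen 5); row T-E3g-GV29o FILE 5; ROUTE-2 II.15.4 ARM α,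
# the `λ`-half of the `Λ`-reading at the non-primitive level)

HONEST FRAMING (cell `b2b-bsdres`, run/shared/lean/b2b/bsd-rank1-residual/, verbatim in every
file): the goal of the cell is to DELETE the COMBINATION-SHAPED residual classes of the
Birch–Swinnerton-Dyer formula for ALL analytic-rank `≤ 1` elliptic curves over `ℚ` — "full BSD
formula for every rank `≤ 1` curve in class `C`" assembled STRICTLY from published theorems — so
that the rank-`≤ 1` remainder becomes exactly the CONSTRUCTION-SHAPED classes, which are TYPED
(missing-input `Prop`s), NOT attempted. This is not "finishing BSD". Team n1011: research routes on
CONSTRUCTION-SHAPED classes; prove what is provable now; no claim beyond stated classes; census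
output = EVIDENCE, never a Literature fact; RESIDUAL-MAP marks UNCHANGED; nothing is booked by this
file. THEOREMS ONLY: no definition, no named fact; gen 3's `Iwasawa.MuZeroQuotientCard` /
`Additive.CongruentPartnerBudgetSchemaHolds` ((L1) `#(X/𝔭X) = p^{λ(X)}`) and eisenstein-p2's X2
algebra are consumed BY NAME and untouched.

## What and why

GV p. 27: "if `μ_{E₁} = 0`, then `μ_{E₂} = 0` and `λ_{E₂,Σ₀} = λ_{E₁,Σ₀}`" — read through Prop. (2.8):
"`S_A(ℚ_∞)` `Λ`-cotorsion with `μ = 0` … then the `λ`-invariant of `S^{Σ₀}_A(ℚ_∞)` is equal to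
`dim_{𝒪/𝔪}(S^{Σ₀}_{A[π]}(ℚ_∞))`", whose proof uses Prop. (2.5) (no proper finite-index
`Λ`-submodules). FILES 3–4 gave `#Sel^{Σ₀}_{E₁}[p] = #Sel^{Σ₀}_{E₂}[p]` and the `μ`/cotorsion transfer
for the non-primitive duals `X^{Σ₀}_i`. Here: for a f.g. torsion `X^{Σ₀}` with `μ = 0` and NO
non-zero finite `Λ`-submodule (the Prop.-(2.5)/Remark-(2.7)-shaped input, an explicit binder `hnf`),
`#Sel^{Σ₀}[p] = #(X^{Σ₀}/pX^{Σ₀}) = p^{λ(X^{Σ₀})}` (Pontryagin + gen 3's (L1)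
`card_quotient_eq_pow_lambdaInvariant_holds`), so equal counts give EQUAL `λ`.

* §1 (any `E/ℚ`, `κ`, `γ`, `Σ₀`) `natCard_torsionBy_nonPrimitiveSelmerInfty_eq_pow_lambdaInvariant`;
  `nonPrimitive_lambdaInvariant_eq_of_natCard_eq` (two curves, along an equality of counts; the
  partner's cotorsion + `μ = 0` come from FILE 4, its `hnf₂` is a binder).
* §2 the four loci: `ClassX4Gord/ClassX3Gord.nonPrimitive_lambdaInvariant_eq_of_torsionIso` (mod
  `hGrK`), `ClassX4M/ClassX3M.…` (mod A40/A41), mixed `ClassX4M.…_of_classX4Gord`,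
  `ClassX3M.…_of_classX3Gord`.

What A240 still carries after FILES 1–5: only the PRIMITIVE ↔ non-primitive passage
(`μ(X) = μ(X^{Σ₀})`, `λ(X^{Σ₀}) = λ(X) + Σ_{v∈Σ₀} δ_v` — GV (7)/Cor. (2.3), printed for good ordinary
or multiplicative `p`) and the SUPPLY of `hnf` (Prop. (2.5)/Remark (2.7)) — typer lane. Nothing
booked; X3♯/X4♯ stay as labelled.

References: [GreenbergVatsal2000] §2 Prop. (2.5), Remark (2.7), Prop. (2.8), pp. 23–27;
[Washington1997] §13.2; ROUTE-2 II.15.4.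
-/

set_option autoImplicit false

noncomputable section

open scoped Classical NumberField AddSubgroup

open NumberField IsDedekindDomain Field WeierstrassCurve
  Literature.NumberTheory.GaloisRepresentations Literature.NumberTheory.EllipticCurves
  Literature.NumberTheory.EllipticCurves.GreenbergSelmer
  Literature.NumberTheory.EllipticCurves.GreenbergVatsal2000
  Literature.NumberTheory.EllipticCurves.EmertonPollackWeston2006
  Literature.NumberTheory.EllipticCurves.Rank1Residual
  Literature.NumberTheory.EllipticCurves.Greenberg1999
  Summit.BirchSwinnertonDyer.Rank1Residual.X2.NonPrimitiveSelmerDual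
  Summit.BirchSwinnertonDyer.Rank1Residual.Iwasawa

/-! ## §1. Algebra: `#Sel^{Σ₀}[p] = p^{λ(X^{Σ₀})}` under `μ = 0` + no finite submodule -/

namespace Summit.BirchSwinnertonDyer.Rank1Residual.Additive

open Summit.BirchSwinnertonDyer.Rank1Residual.X1.CongruenceTransfer (TorsionIso)

section Algebra

variable {p : ℕ} [hp : Fact p.Prime] {W : WeierstrassCurve ℚ} (κ : ZpExtension ℚ p)
  {γ : absoluteGaloisGroup ℚ} (S₀ : Set (HeightOneSpectrum (𝓞 ℚ)))

/-- **`#Sel^{Σ₀}_E(ℚ_∞)_p[p] = p^{λ(X^{Σ₀})}`** for ANY f.g. non-primitive dual datum whose module is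
`Λ`-torsion with `μ = 0` and has NO non-zero finite `Λ`-submodule (GV Prop. (2.8)'s last clause, the
no-finite-submodule input being Prop. (2.5)/Remark (2.7) — here an explicit binder):
`#Sel^{Σ₀}[p] = #Hom(Sel^{Σ₀}, ℚ/ℤ)/p` (Pontryagin, gen 3's `natCard_modN_characterModule_eq`)
`= #(X^{Σ₀}/𝔭X^{Σ₀})` `= p^{λ}` (gen 3's (L1) `card_quotient_eq_pow_lambdaInvariant_holds`).
[cite: GreenbergVatsal2000, §2 Prop. (2.8) (arXiv:math/9906215 p. 25) and Prop. (2.5)] [cite: Washington1997, §13.2] -/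
theorem natCard_torsionBy_nonPrimitiveSelmerInfty_eq_pow_lambdaInvariant
    (DS : NonPrimitiveDualData W κ γ S₀) [Module.Finite (IwasawaAlgebra p) DS.X]
    (ht : Module.IsTorsion (IwasawaAlgebra p) DS.X) (hμ : muInvariant p DS.X = 0)
    (hnf : ∀ N : Submodule (IwasawaAlgebra p) DS.X, Finite N → N = ⊥) :
    Nat.card ((nonPrimitiveSelmerInfty W κ S₀)[(p : ℤ)]) = p ^ lambdaInvariant p DS.X := by
  rw [← card_quotient_eq_pow_lambdaInvariant_holds p DS.X ht hμ hnf,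
    natCard_quotient_augIdealP_smul_top_eq_natCard_modN p,
    Nat.card_congr (modNEquiv (toDualEquiv W κ S₀ DS) p).toEquiv, natCard_modN_characterModule_eq]

end Algebra

section Transfer

variable {p : ℕ} [hp : Fact p.Prime] {W₁ W₂ : WeierstrassCurve ℚ} (κ : ZpExtension ℚ p)
  {γ : absoluteGaloisGroup ℚ} (S₀ : Set (HeightOneSpectrum (𝓞 ℚ)))

/-- **`λ(X^{Σ₀}_1) = λ(X^{Σ₀}_2)` along an equality of counts** (GV p. 27 "`λ_{E₂,Σ₀} = λ_{E₁,Σ₀}`",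
non-primitive duals): `#Sel^{Σ₀}_{E₁}[p] = #Sel^{Σ₀}_{E₂}[p]`, `X^{Σ₀}_1` f.g. torsion with `μ = 0`,
both without non-zero finite `Λ`-submodules ⟹ `X^{Σ₀}_2` is torsion with `μ = 0` (FILE 4) AND
`λ(X^{Σ₀}_1) = λ(X^{Σ₀}_2)` (`p^{λ₁} = p^{λ₂}`).
[cite: GreenbergVatsal2000, §2 Prop. (2.8) and pp. 26–27] -/
theorem nonPrimitive_lambdaInvariant_eq_of_natCard_eq
    (hcount : Nat.card ((nonPrimitiveSelmerInfty W₁ κ S₀)[(p : ℤ)]) =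
      Nat.card ((nonPrimitiveSelmerInfty W₂ κ S₀)[(p : ℤ)]))
    (DS₁ : NonPrimitiveDualData W₁ κ γ S₀) (DS₂ : NonPrimitiveDualData W₂ κ γ S₀)
    [Module.Finite (IwasawaAlgebra p) DS₁.X] [Module.Finite (IwasawaAlgebra p) DS₂.X]
    (ht₁ : Module.IsTorsion (IwasawaAlgebra p) DS₁.X) (hμ₁ : muInvariant p DS₁.X = 0)
    (hnf₁ : ∀ N : Submodule (IwasawaAlgebra p) DS₁.X, Finite N → N = ⊥)
    (hnf₂ : ∀ N : Submodule (IwasawaAlgebra p) DS₂.X, Finite N → N = ⊥) :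
    Module.IsTorsion (IwasawaAlgebra p) DS₂.X ∧ muInvariant p DS₂.X = 0 ∧
      lambdaInvariant p DS₁.X = lambdaInvariant p DS₂.X := by
  obtain ⟨ht₂, hμ₂⟩ :=
    nonPrimitive_isTorsion_and_mu_eq_zero_of_natCard_eq κ S₀ hcount DS₁ DS₂ ht₁ hμ₁
  refine ⟨ht₂, hμ₂, Nat.pow_right_injective hp.out.two_le ?_⟩
  change p ^ lambdaInvariant p DS₁.X = p ^ lambdaInvariant p DS₂.X
  rw [← natCard_torsionBy_nonPrimitiveSelmerInfty_eq_pow_lambdaInvariant κ S₀ DS₁ ht₁ hμ₁ hnf₁,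
    ← natCard_torsionBy_nonPrimitiveSelmerInfty_eq_pow_lambdaInvariant κ S₀ DS₂ ht₂ hμ₂ hnf₂]
  exact hcount

end Transfer

/-! ## §2. The four loci -/

section Gord

variable {p : ℕ} [hp : Fact p.Prime] {W₁ W₂ : WeierstrassCurve ℚ} [W₁.IsElliptic]
  [W₁.IsGloballyMinimal] [W₂.IsElliptic] [W₂.IsGloballyMinimal] (κ : ZpExtension ℚ p)
  {γ : absoluteGaloisGroup ℚ} (S₀ : Set (HeightOneSpectrum (𝓞 ℚ)))

/-- **X4♯(G-ord, `e = 2`) pairs, every odd `p`: `λ(X^{Σ₀}_1) = λ(X^{Σ₀}_2)`** (with the partner's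
cotorsion and `μ = 0`) for f.g. non-primitive duals — `X^{Σ₀}_1` torsion with `μ = 0`, both without
non-zero finite submodules; mod `hGrK` (A239). X4♯ stays CONSTRUCTION-SHAPED; nothing booked.
[cite: GreenbergVatsal2000, §2 Prop. (2.8) and pp. 26–27] [cite: GreenbergLNM1716, §2 Prop. 2.4 (p. 80)] -/
theorem ClassX4Gord.nonPrimitive_lambdaInvariant_eq_of_torsionIso
    (hGrK : imKummer_ge_strictCondition_goodOrdinary) (hκ : κ.IsCyclotomic)
    (hX₁ : ClassX4Gord W₁ p) (he₁ : semistabilityIndex W₁ p = 2)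
    (hX₂ : ClassX4Gord W₂ p) (he₂ : semistabilityIndex W₂ p = 2)
    (hS₀ : ∀ v ∈ S₀, ((p : ℕ) : 𝓞 ℚ) ∉ v.asIdeal)
    (hS₁ : ∀ v : HeightOneSpectrum (𝓞 ℚ), v ∉ S₀ → ((p : ℕ) : 𝓞 ℚ) ∉ v.asIdeal →
      W₁.HasGoodReductionAt v)
    (hS₂ : ∀ v : HeightOneSpectrum (𝓞 ℚ), v ∉ S₀ → ((p : ℕ) : 𝓞 ℚ) ∉ v.asIdeal →
      W₂.HasGoodReductionAt v)
    (hT : TorsionIso W₁ W₂ p)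
    (DS₁ : NonPrimitiveDualData W₁ κ γ S₀) (DS₂ : NonPrimitiveDualData W₂ κ γ S₀)
    [Module.Finite (IwasawaAlgebra p) DS₁.X] [Module.Finite (IwasawaAlgebra p) DS₂.X]
    (ht₁ : Module.IsTorsion (IwasawaAlgebra p) DS₁.X) (hμ₁ : muInvariant p DS₁.X = 0)
    (hnf₁ : ∀ N : Submodule (IwasawaAlgebra p) DS₁.X, Finite N → N = ⊥)
    (hnf₂ : ∀ N : Submodule (IwasawaAlgebra p) DS₂.X, Finite N → N = ⊥) :
    Module.IsTorsion (IwasawaAlgebra p) DS₂.X ∧ muInvariant p DS₂.X = 0 ∧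
      lambdaInvariant p DS₁.X = lambdaInvariant p DS₂.X :=
  nonPrimitive_lambdaInvariant_eq_of_natCard_eq κ S₀
    (ClassX4Gord.natCard_torsionBy_nonPrimitiveSelmerInfty_eq κ S₀ hGrK hκ hX₁ he₁ hX₂ he₂ hS₀ hS₁
      hS₂ hT) DS₁ DS₂ ht₁ hμ₁ hnf₁ hnf₂

/-- **X3♯(G-ord, `e = 2`) pairs, odd `p` (REDUCIBLE `E_i[p]`): the same**, census bit
`p ∤ #E₁(ℚ)_tors`; mod `hGrK`. X3♯ stays as labelled; nothing booked.
[cite: GreenbergVatsal2000, §2 Prop. (2.8) and pp. 26–27] [cite: GreenbergLNM1716, §2 Prop. 2.4 (p. 80)] -/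
theorem ClassX3Gord.nonPrimitive_lambdaInvariant_eq_of_torsionIso
    (hGrK : imKummer_ge_strictCondition_goodOrdinary) (hp2 : p ≠ 2) (hκ : κ.IsCyclotomic)
    (hX₁ : ClassX3Gord W₁ p) (he₁ : semistabilityIndex W₁ p = 2)
    (hX₂ : ClassX3Gord W₂ p) (he₂ : semistabilityIndex W₂ p = 2)
    (htors₁ : ¬ p ∣ W₁.torsionOrder)
    (hS₀ : ∀ v ∈ S₀, ((p : ℕ) : 𝓞 ℚ) ∉ v.asIdeal)
    (hS₁ : ∀ v : HeightOneSpectrum (𝓞 ℚ), v ∉ S₀ → ((p : ℕ) : 𝓞 ℚ) ∉ v.asIdeal →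
      W₁.HasGoodReductionAt v)
    (hS₂ : ∀ v : HeightOneSpectrum (𝓞 ℚ), v ∉ S₀ → ((p : ℕ) : 𝓞 ℚ) ∉ v.asIdeal →
      W₂.HasGoodReductionAt v)
    (hT : TorsionIso W₁ W₂ p)
    (DS₁ : NonPrimitiveDualData W₁ κ γ S₀) (DS₂ : NonPrimitiveDualData W₂ κ γ S₀)
    [Module.Finite (IwasawaAlgebra p) DS₁.X] [Module.Finite (IwasawaAlgebra p) DS₂.X]
    (ht₁ : Module.IsTorsion (IwasawaAlgebra p) DS₁.X) (hμ₁ : muInvariant p DS₁.X = 0)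
    (hnf₁ : ∀ N : Submodule (IwasawaAlgebra p) DS₁.X, Finite N → N = ⊥)
    (hnf₂ : ∀ N : Submodule (IwasawaAlgebra p) DS₂.X, Finite N → N = ⊥) :
    Module.IsTorsion (IwasawaAlgebra p) DS₂.X ∧ muInvariant p DS₂.X = 0 ∧
      lambdaInvariant p DS₁.X = lambdaInvariant p DS₂.X :=
  nonPrimitive_lambdaInvariant_eq_of_natCard_eq κ S₀
    (ClassX3Gord.natCard_torsionBy_nonPrimitiveSelmerInfty_eq κ S₀ hGrK hp2 hκ hX₁ he₁ hX₂ he₂ htors₁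
      hS₀ hS₁ hS₂ hT) DS₁ DS₂ ht₁ hμ₁ hnf₁ hnf₂

end Gord

end Summit.BirchSwinnertonDyer.Rank1Residual.Additive

namespace Summit.BirchSwinnertonDyer.Rank1Residual.AdditivePotMult

open Summit.BirchSwinnertonDyer.Rank1Residual.Additive
open Summit.BirchSwinnertonDyer.Rank1Residual.X1.CongruenceTransfer (TorsionIso)

section PotMultPairs

variable {p : ℕ} [hp : Fact p.Prime] {W₁ W₂ : WeierstrassCurve ℚ} [W₁.IsElliptic] [W₂.IsElliptic]
  (κ : ZpExtension ℚ p) {γ : absoluteGaloisGroup ℚ} (S₀ : Set (HeightOneSpectrum (𝓞 ℚ)))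

/-- **X4(M) pairs, every odd `p`: `λ(X^{Σ₀}_1) = λ(X^{Σ₀}_2)`** (with the partner's cotorsion and
`μ = 0`), f.g. non-primitive duals without non-zero finite submodules; mod A40/A41. X4(M) stays
CONSTRUCTION-SHAPED; nothing booked. [cite: GreenbergVatsal2000, §2 Prop. (2.8) and pp. 26–27]
[cite: SilvermanATAEC1994, Ch. V Thm. 5.3, Cor. 5.4] -/
theorem ClassX4M.nonPrimitive_lambdaInvariant_eq_of_torsionIso
    (hT40 : Silverman1994_thmV53_tateUniformisation.{0})
    (hT41 : Silverman1994_thmV53_corV54_tateUniformisation.{0}) (hκ : κ.IsCyclotomic)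
    (hX₁ : ClassX4M W₁ p) (hX₂ : ClassX4M W₂ p)
    (hS₀ : ∀ v ∈ S₀, ((p : ℕ) : 𝓞 ℚ) ∉ v.asIdeal)
    (hS₁ : ∀ v : HeightOneSpectrum (𝓞 ℚ), v ∉ S₀ → ((p : ℕ) : 𝓞 ℚ) ∉ v.asIdeal →
      W₁.HasGoodReductionAt v)
    (hS₂ : ∀ v : HeightOneSpectrum (𝓞 ℚ), v ∉ S₀ → ((p : ℕ) : 𝓞 ℚ) ∉ v.asIdeal →
      W₂.HasGoodReductionAt v)
    (hT : TorsionIso W₁ W₂ p)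
    (DS₁ : NonPrimitiveDualData W₁ κ γ S₀) (DS₂ : NonPrimitiveDualData W₂ κ γ S₀)
    [Module.Finite (IwasawaAlgebra p) DS₁.X] [Module.Finite (IwasawaAlgebra p) DS₂.X]
    (ht₁ : Module.IsTorsion (IwasawaAlgebra p) DS₁.X) (hμ₁ : muInvariant p DS₁.X = 0)
    (hnf₁ : ∀ N : Submodule (IwasawaAlgebra p) DS₁.X, Finite N → N = ⊥)
    (hnf₂ : ∀ N : Submodule (IwasawaAlgebra p) DS₂.X, Finite N → N = ⊥) :
    Module.IsTorsion (IwasawaAlgebra p) DS₂.X ∧ muInvariant p DS₂.X = 0 ∧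
      lambdaInvariant p DS₁.X = lambdaInvariant p DS₂.X :=
  nonPrimitive_lambdaInvariant_eq_of_natCard_eq κ S₀
    (ClassX4M.natCard_torsionBy_nonPrimitiveSelmerInfty_eq κ S₀ hT40 hT41 hκ hX₁ hX₂ hS₀ hS₁ hS₂ hT)
    DS₁ DS₂ ht₁ hμ₁ hnf₁ hnf₂

/-- **X3♯(M) pairs, odd `p` (REDUCIBLE `E_i[p]`): the same**, census bit `p ∤ #E₁(ℚ)_tors`; mod
A40/A41. X3♯(M) stays as labelled; nothing booked. [cite: GreenbergVatsal2000, §2 Prop. (2.8) and pp. 26–27]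
[cite: SilvermanATAEC1994, Ch. V Thm. 5.3, Cor. 5.4] -/
theorem ClassX3M.nonPrimitive_lambdaInvariant_eq_of_torsionIso [W₁.IsGloballyMinimal]
    [W₂.IsGloballyMinimal] (hT40 : Silverman1994_thmV53_tateUniformisation.{0})
    (hT41 : Silverman1994_thmV53_corV54_tateUniformisation.{0}) (hκ : κ.IsCyclotomic)
    (hX₁ : ClassX3M W₁ p) (hX₂ : ClassX3M W₂ p) (htors₁ : ¬ p ∣ W₁.torsionOrder)
    (hS₀ : ∀ v ∈ S₀, ((p : ℕ) : 𝓞 ℚ) ∉ v.asIdeal)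
    (hS₁ : ∀ v : HeightOneSpectrum (𝓞 ℚ), v ∉ S₀ → ((p : ℕ) : 𝓞 ℚ) ∉ v.asIdeal →
      W₁.HasGoodReductionAt v)
    (hS₂ : ∀ v : HeightOneSpectrum (𝓞 ℚ), v ∉ S₀ → ((p : ℕ) : 𝓞 ℚ) ∉ v.asIdeal →
      W₂.HasGoodReductionAt v)
    (hT : TorsionIso W₁ W₂ p)
    (DS₁ : NonPrimitiveDualData W₁ κ γ S₀) (DS₂ : NonPrimitiveDualData W₂ κ γ S₀)
    [Module.Finite (IwasawaAlgebra p) DS₁.X] [Module.Finite (IwasawaAlgebra p) DS₂.X]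
    (ht₁ : Module.IsTorsion (IwasawaAlgebra p) DS₁.X) (hμ₁ : muInvariant p DS₁.X = 0)
    (hnf₁ : ∀ N : Submodule (IwasawaAlgebra p) DS₁.X, Finite N → N = ⊥)
    (hnf₂ : ∀ N : Submodule (IwasawaAlgebra p) DS₂.X, Finite N → N = ⊥) :
    Module.IsTorsion (IwasawaAlgebra p) DS₂.X ∧ muInvariant p DS₂.X = 0 ∧
      lambdaInvariant p DS₁.X = lambdaInvariant p DS₂.X :=
  nonPrimitive_lambdaInvariant_eq_of_natCard_eq κ S₀
    (ClassX3M.natCard_torsionBy_nonPrimitiveSelmerInfty_eq κ S₀ hT40 hT41 hκ hX₁ hX₂ htors₁ hS₀ hS₁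
      hS₂ hT) DS₁ DS₂ ht₁ hμ₁ hnf₁ hnf₂

end PotMultPairs

section Mixed

variable {p : ℕ} [hp : Fact p.Prime] {W₁ W₂ : WeierstrassCurve ℚ} [W₁.IsElliptic]
  [W₁.IsGloballyMinimal] [W₂.IsElliptic] (κ : ZpExtension ℚ p) {γ : absoluteGaloisGroup ℚ}
  (S₀ : Set (HeightOneSpectrum (𝓞 ℚ)))

/-- **X4♯(G-ord, `e = 2`) × X4(M), every odd `p`: `λ(X^{Σ₀}_1) = λ(X^{Σ₀}_2)`** (with the (M)
partner's cotorsion and `μ = 0`), f.g. non-primitive duals without non-zero finite submodules;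
mod `hGrK` / A40–A41. Nothing booked. [cite: GreenbergVatsal2000, §2 Prop. (2.8) and pp. 26–27]
[cite: SilvermanATAEC1994, Ch. V Thm. 5.3, Cor. 5.4] -/
theorem ClassX4M.nonPrimitive_lambdaInvariant_eq_of_classX4Gord
    (hGrK : imKummer_ge_strictCondition_goodOrdinary)
    (hT40 : Silverman1994_thmV53_tateUniformisation.{0})
    (hT41 : Silverman1994_thmV53_corV54_tateUniformisation.{0}) (hκ : κ.IsCyclotomic)
    (hX₁ : ClassX4Gord W₁ p) (he₁ : semistabilityIndex W₁ p = 2) (hX₂ : ClassX4M W₂ p)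
    (hS₀ : ∀ v ∈ S₀, ((p : ℕ) : 𝓞 ℚ) ∉ v.asIdeal)
    (hS₁ : ∀ v : HeightOneSpectrum (𝓞 ℚ), v ∉ S₀ → ((p : ℕ) : 𝓞 ℚ) ∉ v.asIdeal →
      W₁.HasGoodReductionAt v)
    (hS₂ : ∀ v : HeightOneSpectrum (𝓞 ℚ), v ∉ S₀ → ((p : ℕ) : 𝓞 ℚ) ∉ v.asIdeal →
      W₂.HasGoodReductionAt v)
    (hT : TorsionIso W₁ W₂ p)
    (DS₁ : NonPrimitiveDualData W₁ κ γ S₀) (DS₂ : NonPrimitiveDualData W₂ κ γ S₀)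
    [Module.Finite (IwasawaAlgebra p) DS₁.X] [Module.Finite (IwasawaAlgebra p) DS₂.X]
    (ht₁ : Module.IsTorsion (IwasawaAlgebra p) DS₁.X) (hμ₁ : muInvariant p DS₁.X = 0)
    (hnf₁ : ∀ N : Submodule (IwasawaAlgebra p) DS₁.X, Finite N → N = ⊥)
    (hnf₂ : ∀ N : Submodule (IwasawaAlgebra p) DS₂.X, Finite N → N = ⊥) :
    Module.IsTorsion (IwasawaAlgebra p) DS₂.X ∧ muInvariant p DS₂.X = 0 ∧
      lambdaInvariant p DS₁.X = lambdaInvariant p DS₂.X :=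
  nonPrimitive_lambdaInvariant_eq_of_natCard_eq κ S₀
    (ClassX4M.natCard_torsionBy_nonPrimitiveSelmerInfty_eq_of_classX4Gord κ S₀ hGrK hT40 hT41 hκ hX₁
      he₁ hX₂ hS₀ hS₁ hS₂ hT) DS₁ DS₂ ht₁ hμ₁ hnf₁ hnf₂

/-- **X3♯(G-ord, `e = 2`) × X3♯(M), odd `p`: `λ(X^{Σ₀}_1) = λ(X^{Σ₀}_2)`** (with the (M) partner's
cotorsion and `μ = 0`; census bit `p ∤ #E₁(ℚ)_tors`), mod `hGrK` / A40–A41. Nothing booked.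
[cite: GreenbergVatsal2000, §2 Prop. (2.8) and pp. 26–27] [cite: SilvermanATAEC1994, Ch. V Thm. 5.3, Cor. 5.4] -/
theorem ClassX3M.nonPrimitive_lambdaInvariant_eq_of_classX3Gord [W₂.IsGloballyMinimal]
    (hGrK : imKummer_ge_strictCondition_goodOrdinary)
    (hT40 : Silverman1994_thmV53_tateUniformisation.{0})
    (hT41 : Silverman1994_thmV53_corV54_tateUniformisation.{0}) (hp2 : p ≠ 2) (hκ : κ.IsCyclotomic)
    (hX₁ : ClassX3Gord W₁ p) (he₁ : semistabilityIndex W₁ p = 2) (hX₂ : ClassX3M W₂ p)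
    (htors₁ : ¬ p ∣ W₁.torsionOrder)
    (hS₀ : ∀ v ∈ S₀, ((p : ℕ) : 𝓞 ℚ) ∉ v.asIdeal)
    (hS₁ : ∀ v : HeightOneSpectrum (𝓞 ℚ), v ∉ S₀ → ((p : ℕ) : 𝓞 ℚ) ∉ v.asIdeal →
      W₁.HasGoodReductionAt v)
    (hS₂ : ∀ v : HeightOneSpectrum (𝓞 ℚ), v ∉ S₀ → ((p : ℕ) : 𝓞 ℚ) ∉ v.asIdeal →
      W₂.HasGoodReductionAt v)
    (hT : TorsionIso W₁ W₂ p)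
    (DS₁ : NonPrimitiveDualData W₁ κ γ S₀) (DS₂ : NonPrimitiveDualData W₂ κ γ S₀)
    [Module.Finite (IwasawaAlgebra p) DS₁.X] [Module.Finite (IwasawaAlgebra p) DS₂.X]
    (ht₁ : Module.IsTorsion (IwasawaAlgebra p) DS₁.X) (hμ₁ : muInvariant p DS₁.X = 0)
    (hnf₁ : ∀ N : Submodule (IwasawaAlgebra p) DS₁.X, Finite N → N = ⊥)
    (hnf₂ : ∀ N : Submodule (IwasawaAlgebra p) DS₂.X, Finite N → N = ⊥) :
    Module.IsTorsion (IwasawaAlgebra p) DS₂.X ∧ muInvariant p DS₂.X = 0 ∧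
      lambdaInvariant p DS₁.X = lambdaInvariant p DS₂.X :=
  nonPrimitive_lambdaInvariant_eq_of_natCard_eq κ S₀
    (ClassX3M.natCard_torsionBy_nonPrimitiveSelmerInfty_eq_of_classX3Gord κ S₀ hGrK hT40 hT41 hp2 hκ
      hX₁ he₁ hX₂ htors₁ hS₀ hS₁ hS₂ hT) DS₁ DS₂ ht₁ hμ₁ hnf₁ hnf₂

end Mixed

end Summit.BirchSwinnertonDyer.Rank1Residual.AdditivePotMult

end
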